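import Summits.HodgeConjecture.CorCM.DecicCurveFivefoldWeilAiming
import HarnessLib

/-!
# COR-CM — the Weil SIXFOLD `B × E × E` of a CM fourfold of `k`-signature `(1,3)` and two copies of the CM curve of `k`:
# Weil type `(3,3)` from the type count, and the Weil plane algebraic GIVEN Markman's hyperbolic-sixfold theorem

Cell `pub-hodgecm2` (COR-CM), seat b30 gen 18 (2026-08-21); count-neutral own lane OCTIC-EB (lit-andre-3's prover-lane ask
A6-R26, generalised to every octic CM field containing `k`).  Theorems only; no definition, no named fact,
no `sorry`.  HONEST FRAMING: nothing unconditional about the Hodge conjecture is concluded; the algebraicity statements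
are CONDITIONAL on the displayed named fact `HodgeTheory.Markman2025_weilClasses_algebraic_hyperbolicSixfold` (E. Markman,
arXiv:2502.03415 Thm 1.5.1, UNREFEREED); `HC_CM` is not asserted.

* §1 `card_filter_comp_eq_four` — each complex embedding of the quadratic `k` has four extensions to the octic `F`.
* §2 **`isWeilType_cmFourfold_prod_cmCurve_prod_cmCurve`** — for `B ⊨ (F; Ψ)` (`[F:ℚ] = 8`), `E ⊨ (k; Φ₀)` (`[k:ℚ] = 2`),
  `δ ∈ 𝓞_k`, `δ² = -d < 0`, and `φ = (ι_B(iδ) × ι_E(δ)) × ι_E(δ)` on `(B × E) × E`: the TYPE COUNT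
  `#{s ∈ Ψ | s ∘ i = τ} + 2·[τ ∈ Φ₀] = 3` (all `τ`; i.e. `k`-signature `(1,3)` of `Ψ` against `Φ₀ = {τ}`) gives Weil type
  `(3, d)` — six independent `i√d`-eigenvectors `fst^*fst^* v_s`, `fst^*snd^* u`, `snd^* u` with Hodge types summing to
  `(3,3)` (seat b24's `WeilFourfold.isWeilType_of_cupPowOne`; the pattern of seat b09's `isWeilType_cmFivefold_prod_cmCurve`).
* §3 **`weilClassesOf_le_algebraicClasses_…_of_markmanSixfold`** — GIVEN Markman's theorem, the whole Weil plane of the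
  sixfold is algebraic: `(B × E) × E` is a FOURFOLD TIMES TWO CURVES, for which ring 2 (seat ab-weil-2,
  `Ring2.AbelianAll.weilClasses_algebraic_fourfold_prod_curve_prod_curve_of_markmanSixfolds`) proved that a weighted Segre
  polarisation is HYPERBOLIC («factorwise rescaling», van Geemen 5.2–5.4 / Landherr), so Thm 1.5.1 applies directly; Weil
  type upgrades the pointwise statement to the complex plane (van Geemen 4.9).
The sequel `CorCM/OcticCurveFourfoldWeilParts.lean` transports the plane to `⨁_{m<3}` and proves that the WEIL PARTS of every
product of copies of `B`, `E` (the curve used twice) have algebraic lines.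
[cite: Deligne1982HodgeCycles, §4 Prop. 4.4 and §5 (c)] [cite: vanGeemen1994HodgeAV, 4.9–4.10, Lemma 5.2 (2)–(4), (5.4.1)]
[cite: Markman2025SecantWeil, Thm 1.5.1] [cite: Milne2020HodgeClassesAV, 1.2 (a) and Thm. 1] [cite: MoonenZarhin1999LowDim, Thm. 0.1 (a)]

## References
* [Markman2025SecantWeil] E. Markman, arXiv:2502.03415 (unrefereed), Thm 1.5.1 (`HodgeTheory/WeilClassesSixfolds.lean`).
* [Deligne1982HodgeCycles] P. Deligne (notes by J. S. Milne), LNM 900 (1982), §4 Prop. 4.4, §5 (c).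
* [vanGeemen1994HodgeAV] B. van Geemen, LNM 1594 (1994), 4.9–4.10, Lemma 5.2 (2)–(4), 5.4 and (5.4.1).
* [Milne2020HodgeClassesAV] J. S. Milne, arXiv:2010.08857, 1.2 (a), Thm. 1.
* [MoonenZarhin1999LowDim] B. Moonen, Yu. Zarhin, Math. Ann. 315 (1999), Thm. 0.1 (a) (`X × E_k`).
-/

noncomputable section

namespace Summit.HodgeConjecture.CorCM.OcticCurveFourfold

open CategoryTheory CategoryTheory.Limits NumberField
open Literature.AlgebraicGeometry Literature.AlgebraicGeometry.Motives Literature.AlgebraicGeometry.HodgeTheory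
open Literature.AlgebraicGeometry.ComplexMultiplication (IsCMTypeRealisation)
open Literature.AlgebraicGeometry.Pohlmann1968
open Literature.AlgebraicTopology.SingularHomology
open Literature.NumberTheory.Automorphic.PicardCM (eigenline)
open Summit.HodgeConjecture.CorCM.AndreProductForm
  (exists_eigenbasis map_ι_apply_of_mem_eigenline isOfHodgeType_oneZero_of_mem isOfHodgeType_zeroOne_of_not_mem)
open Summit.HodgeConjecture.CorCM.WeilFourfold (comp_self_eq_neg_of_sq_eq_neg dim_eq_of_isCMTypeRealisation
  exists_apply_eq_I_mul_sqrt isWeilType_of_cupPowOne)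

/-! ## §1 Extensions of a complex embedding along a degree-four extension of number fields -/

section Fibre

open scoped Classical

variable {K : Type} [Field K] [NumberField K] {k : Type} [Field k] [NumberField k]

/-- **Each complex embedding of `k` has exactly four extensions to `K`** along `i : k → K`, `[k:ℚ] = 2`, `[K:ℚ] = 8`
(the `k`-algebra maps `K →ₐ[k] ℂ`, `[K:k] = 4` of them: Mathlib `AlgHom.card`, tower law). [folklore] -/
theorem card_filter_comp_eq_four (i : k →+* K) (h8 : Module.finrank ℚ K = 8) (h2 : Module.finrank ℚ k = 2)
    (τ : k →+* ℂ) :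
    (Finset.univ.filter fun s : K →+* ℂ => s.comp i = τ).card = 4 := by
  classical
  letI : Algebra k K := i.toAlgebra
  letI : Algebra k ℂ := τ.toAlgebra
  haveI : IsScalarTower ℚ k K := IsScalarTower.of_algebraMap_eq fun q => by
    rw [RingHom.algebraMap_toAlgebra, eq_ratCast, eq_ratCast, map_ratCast]
  haveI : FiniteDimensional k K := FiniteDimensional.right ℚ k K
  have hkK : Module.finrank k K = 4 := by
    have h := Module.finrank_mul_finrank ℚ k K
    rw [h2, h8] at h
    omega
  have hcomm : ∀ f : K →ₐ[k] ℂ, f.toRingHom.comp i = τ := fun f =>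
    RingHom.ext fun x => f.commutes x
  have hcomm' : ∀ s : {s : K →+* ℂ // s.comp i = τ}, ∀ x : k,
      s.1.toFun (algebraMap k K x) = algebraMap k ℂ x := fun s x => RingHom.congr_fun s.2 x
  let eqv : (K →ₐ[k] ℂ) ≃ {s : K →+* ℂ // s.comp i = τ} :=
    { toFun := fun f => ⟨f.toRingHom, hcomm f⟩
      invFun := fun s => ⟨s.1, hcomm' s⟩
      left_inv := fun f => AlgHom.ext fun x => rfl
      right_inv := fun s => Subtype.ext (RingHom.ext fun x => rfl) }
  rw [← Fintype.card_subtype, ← Fintype.card_congr eqv, AlgHom.card, hkK]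

end Fibre

/-! ## §2 The sixfold `(B × E) × E`: Weil type `(3,3)` from the type count -/

section CM

open scoped Classical

variable {K : Type} [Field K] [NumberField K] {k : Type} [Field k] [NumberField k]

/-- **Weil type of the CM sixfold `(B × E) × E` from the TYPE COUNT** (Deligne 1982 §5 (c)).  For realisations
`B ⊨ (K; Ψ)` (`[K:ℚ] = 8`), `E ⊨ (k; Φ₀)` (`[k:ℚ] = 2`), `i : k →+* K`, `δ ∈ 𝓞_k` with `δ² = -d`, `0 < d`, and
`φ := (ι_B(i δ) × ι_E(δ)) × ι_E(δ)` on `(B × E) × E`: if `#{s ∈ Ψ : s ∘ i = τ} + 2·[τ ∈ Φ₀] = 3` for every `τ : k → ℂ`,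
then `((B × E) × E, φ)` is of Weil type `(3, d)` — for `τ₊` with `τ₊(δ) = i√d`, the classes `fst^*fst^* v_s` (`s ∘ i = τ₊`),
`fst^*snd^* u_{τ₊}` and `snd^* u_{τ₊}` are six independent `i√d`-eigenvectors of `φ^*` whose Hodge types sum to `(3,3)`.
[cite: Deligne1982HodgeCycles, §5 (c) and §4 Prop. 4.4] [cite: vanGeemen1994HodgeAV, 4.9–4.10] -/
theorem isWeilType_cmFourfold_prod_cmCurve_prod_cmCurve
    (h8 : Module.finrank ℚ K = 8) (h2 : Module.finrank ℚ k = 2) (i : k →+* K)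
    {Ψ : CMType K} {B : AbelianVariety ℂ} {ιB : 𝓞 K →+* End B} {θB : K →+* Module.End ℂ (complexBetti B.X 1)}
    (hB : IsCMTypeRealisation Ψ B ιB θB)
    {Φ₀ : CMType k} {E : AbelianVariety ℂ} {ιE : 𝓞 k →+* End E} {θE : k →+* Module.End ℂ (complexBetti E.X 1)}
    (hE : IsCMTypeRealisation Φ₀ E ιE θE)
    {δ : 𝓞 k} {d : ℕ} (hd : 0 < d) (hδ : ((δ : k)) ^ 2 = -(d : k))
    (hcount : ∀ τ : k →+* ℂ,
      (Finset.univ.filter fun s : K →+* ℂ => s.comp i = τ ∧ s ∈ Ψ.1).card + 2 * (if τ ∈ Φ₀.1 then 1 else 0) = 3) :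
    IsWeilType ((B.prod E).prod E)
      (AbelianVariety.prodLift
        (AbelianVariety.fst (B.prod E) E ≫
          AbelianVariety.prodLift (AbelianVariety.fst B E ≫ ιB (RingOfIntegers.mapRingHom i δ))
            (AbelianVariety.snd B E ≫ ιE δ))
        (AbelianVariety.snd (B.prod E) E ≫ ιE δ)) 3 d := by
  classical
  -- notation
  set δK : 𝓞 K := RingOfIntegers.mapRingHom i δ with hδKdef
  set φ₅ : B.prod E ⟶ B.prod E :=
    AbelianVariety.prodLift (AbelianVariety.fst B E ≫ ιB δK) (AbelianVariety.snd B E ≫ ιE δ) with hφ₅def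
  set Y := (B.prod E).prod E with hYdef
  set φY : Y ⟶ Y :=
    AbelianVariety.prodLift (AbelianVariety.fst (B.prod E) E ≫ φ₅) (AbelianVariety.snd (B.prod E) E ≫ ιE δ) with hφYdef
  set μ : ℂ := Complex.I * (Real.sqrt d : ℂ) with hμdef
  -- squares
  have hδ𝓞 : δ ^ 2 = -(d : 𝓞 k) := by
    apply RingOfIntegers.ext
    change algebraMap (𝓞 k) k (δ ^ 2) = algebraMap (𝓞 k) k (-(d : 𝓞 k))
    rw [map_pow, map_neg, map_natCast]
    exact hδ
  have hδK : ((δK : K)) ^ 2 = -(d : K) := by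
    rw [hδKdef, RingOfIntegers.mapRingHom_apply, ← map_pow, hδ, map_neg, map_natCast]
  have hδK𝓞 : δK ^ 2 = -(d : 𝓞 K) := by
    apply RingOfIntegers.ext
    change algebraMap (𝓞 K) K (δK ^ 2) = algebraMap (𝓞 K) K (-(d : 𝓞 K))
    rw [map_pow, map_neg, map_natCast]
    exact hδK
  have hφ₅ : φ₅ ≫ φ₅ = -(d • 𝟙 (B.prod E)) :=
    prodLift_comp_self_eq_neg_nsmul (comp_self_eq_neg_of_sq_eq_neg ιB hδK𝓞) (comp_self_eq_neg_of_sq_eq_neg ιE hδ𝓞)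
  have hφY : φY ≫ φY = -(d • 𝟙 Y) :=
    prodLift_comp_self_eq_neg_nsmul hφ₅ (comp_self_eq_neg_of_sq_eq_neg ιE hδ𝓞)
  -- dimensions
  have hB4 : B.dim = 4 := by rw [dim_eq_of_isCMTypeRealisation hB, h8]
  have hE1 : E.dim = 1 := by rw [dim_eq_of_isCMTypeRealisation hE, h2]
  have hdim : Y.dim = 2 * 3 := by rw [hYdef, AbelianVariety.dim_prod, AbelianVariety.dim_prod, hB4, hE1]
  have hYsp : IsSmoothProjective (2 * 3) Y.X := isSmoothProjective_of_dim_eq' hdim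
  -- eigenbases of the factors
  obtain ⟨v, hv⟩ := AndreProductForm.exists_eigenbasis hB
  obtain ⟨u, hu⟩ := AndreProductForm.exists_eigenbasis hE
  -- the embedding `τ₊` with `τ₊(δ) = i√d` and its four extensions
  obtain ⟨τ, hτ⟩ := exists_apply_eq_I_mul_sqrt hδ
  set F : Finset (K →+* ℂ) := Finset.univ.filter fun s : K →+* ℂ => s.comp i = τ with hFdef
  have hF : F.card = 4 := card_filter_comp_eq_four i h8 h2 τ
  let e : Fin 4 ≃ {s // s ∈ F} := (F.equivFinOfCardEq hF).symm
  let sF : Fin 4 → (K →+* ℂ) := fun m => (e m).1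
  have hsF : ∀ m, (sF m).comp i = τ := fun m => (Finset.mem_filter.mp (e m).2).2
  have hsF_inj : Function.Injective sF := Subtype.val_injective.comp e.injective
  -- the six eigenvectors
  let xB : Fin 4 → complexBetti Y.X 1 := fun m =>
    complexBetti.map (AbelianVariety.fst (B.prod E) E).hom.hom.hom 1
      (complexBetti.map (AbelianVariety.fst B E).hom.hom.hom 1 (v (sF m)))
  let xE1 : complexBetti Y.X 1 :=
    complexBetti.map (AbelianVariety.fst (B.prod E) E).hom.hom.hom 1
      (complexBetti.map (AbelianVariety.snd B E).hom.hom.hom 1 (u τ))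
  let xE2 : complexBetti Y.X 1 := complexBetti.map (AbelianVariety.snd (B.prod E) E).hom.hom.hom 1 (u τ)
  let w : Fin 6 → complexBetti Y.X 1 := Fin.cons xE2 (Fin.cons xE1 xB)
  -- eigenvectors of `φ^*`
  have hvK : ∀ m, complexBetti.map (ιB δK).hom.hom.hom 1 (v (sF m)) = μ • v (sF m) := by
    intro m
    rw [map_ι_apply_of_mem_eigenline hB (hv (sF m)) δK]
    congr 1
    rw [hδKdef, RingOfIntegers.mapRingHom_apply, ← RingHom.comp_apply, hsF m, hτ]
  have huk : complexBetti.map (ιE δ).hom.hom.hom 1 (u τ) = μ • u τ := by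
    rw [map_ι_apply_of_mem_eigenline hE (hu τ) δ, hτ]
  have hw : ∀ j, w j ∈ Module.End.eigenspace (complexBetti.map φY.hom.hom.hom 1).hom μ := by
    intro j
    rw [Module.End.mem_eigenspace_iff]
    refine Fin.cases ?_ (fun j' => Fin.cases ?_ (fun m => ?_) j') j
    · change complexBetti.map φY.hom.hom.hom 1 xE2 = μ • xE2
      rw [hφYdef, map_prodLift_map_snd, huk, map_smul]
    · change complexBetti.map φY.hom.hom.hom 1 xE1 = μ • xE1
      rw [hφYdef, map_prodLift_map_fst, hφ₅def, map_prodLift_map_snd, huk, map_smul, map_smul]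
    · change complexBetti.map φY.hom.hom.hom 1 (xB m) = μ • xB m
      rw [hφYdef, map_prodLift_map_fst, hφ₅def, map_prodLift_map_fst, hvK, map_smul, map_smul]
  -- linear independence
  have hli : LinearIndependent ℂ w := by
    rw [Fintype.linearIndependent_iff]
    intro g hg
    rw [Fin.sum_univ_succ, Fin.sum_univ_succ] at hg
    simp only [w, Fin.cons_zero, Fin.cons_succ] at hg
    -- project to `B × E` along the section `(𝟙, 0)`, then to `B` and to `E`
    have h1 := congrArg (complexBetti.map (AbelianVariety.prodLift (𝟙 (B.prod E)) (0 : B.prod E ⟶ E)).hom.hom.hom 1) hg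
    rw [map_add, map_add, map_smul, map_smul, map_sum, map_zero, map_inlSection_map_snd_one, smul_zero, zero_add,
      map_inlSection_map_fst_one] at h1
    have h1' : g (Fin.succ 0) • complexBetti.map (AbelianVariety.snd B E).hom.hom.hom 1 (u τ) +
        ∑ m : Fin 4, g (m.succ.succ) • complexBetti.map (AbelianVariety.fst B E).hom.hom.hom 1 (v (sF m)) = 0 := by
      rw [← h1]
      congr 1
      refine Finset.sum_congr rfl fun m _ => ?_
      rw [map_smul, map_inlSection_map_fst_one]
    -- project `B × E → B`
    have h2' := congrArg (complexBetti.map (AbelianVariety.prodLift (𝟙 B) (0 : B ⟶ E)).hom.hom.hom 1) h1'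
    rw [map_add, map_smul, map_sum, map_zero, map_inlSection_map_snd_one, smul_zero, zero_add] at h2'
    have h2'' : ∑ m : Fin 4, g m.succ.succ • v (sF m) = 0 := by
      rw [← h2']
      refine Finset.sum_congr rfl fun m _ => ?_
      rw [map_smul, map_inlSection_map_fst_one]
    have hv4 : LinearIndependent ℂ (fun m : Fin 4 => v (sF m)) := v.linearIndependent.comp sF hsF_inj
    have hgB : ∀ m : Fin 4, g m.succ.succ = 0 := Fintype.linearIndependent_iff.mp hv4 (fun m => g m.succ.succ) h2''
    -- project `B × E → E`
    have h3' := congrArg (complexBetti.map (AbelianVariety.prodLift (0 : E ⟶ B) (𝟙 E)).hom.hom.hom 1) h1'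
    rw [map_add, map_smul, map_sum, map_zero, map_inrSection_map_snd_one] at h3'
    have hsum0 : ∑ m : Fin 4, complexBetti.map (AbelianVariety.prodLift (0 : E ⟶ B) (𝟙 E)).hom.hom.hom 1
        (g m.succ.succ • complexBetti.map (AbelianVariety.fst B E).hom.hom.hom 1 (v (sF m))) = 0 :=
      Finset.sum_eq_zero fun m _ => by rw [map_smul, map_inrSection_map_fst_one, smul_zero]
    rw [hsum0, add_zero] at h3'
    have hg1 : g (Fin.succ 0) = 0 := by
      rcases smul_eq_zero.mp h3' with h | h
      · exact h
      · exact absurd h (u.ne_zero τ)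
    -- project `Y → E` along the section `(0, 𝟙)`
    have h4' := congrArg (complexBetti.map (AbelianVariety.prodLift (0 : E ⟶ B.prod E) (𝟙 E)).hom.hom.hom 1) hg
    rw [map_add, map_add, map_smul, map_smul, map_sum, map_zero, map_inrSection_map_snd_one,
      map_inrSection_map_fst_one, smul_zero] at h4'
    have hsum0' : ∑ m : Fin 4, complexBetti.map (AbelianVariety.prodLift (0 : E ⟶ B.prod E) (𝟙 E)).hom.hom.hom 1
        (g m.succ.succ • xB m) = 0 :=
      Finset.sum_eq_zero fun m _ => by
        change complexBetti.map _ 1 (g m.succ.succ • complexBetti.map (AbelianVariety.fst (B.prod E) E).hom.hom.hom 1 _) = 0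
        rw [map_smul, map_inrSection_map_fst_one, smul_zero]
    rw [hsum0', add_zero, add_zero] at h4'
    have hg0 : g 0 = 0 := by
      rcases smul_eq_zero.mp h4' with h | h
      · exact h
      · exact absurd h (u.ne_zero τ)
    intro j
    exact Fin.cases hg0 (fun j' => Fin.cases hg1 hgB j') j
  -- Hodge types
  let pE : ℕ := if τ ∈ Φ₀.1 then 1 else 0
  let qE : ℕ := if τ ∈ Φ₀.1 then 0 else 1
  let p : Fin 6 → ℕ := Fin.cons pE (Fin.cons pE fun m => if sF m ∈ Ψ.1 then 1 else 0)
  let q : Fin 6 → ℕ := Fin.cons qE (Fin.cons qE fun m => if sF m ∈ Ψ.1 then 0 else 1)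
  have huτ : IsOfHodgeType E.dim E.X 1 pE qE (u τ) := by
    by_cases hτΦ : τ ∈ Φ₀.1
    · simp only [pE, qE, if_pos hτΦ]
      exact (isOfHodgeType_oneZero_of_mem hE (hu τ) hτΦ)
    · simp only [pE, qE, if_neg hτΦ]
      exact (isOfHodgeType_zeroOne_of_not_mem hE (hu τ) hτΦ)
  have hBEsp : IsSmoothProjective (B.prod E).dim (B.prod E).X := AbelianVariety.isSmoothProjective_holds
  have hpq : ∀ j, IsOfHodgeType (2 * 3) Y.X 1 (p j) (q j) (w j) := by
    intro j
    refine Fin.cases ?_ (fun j' => Fin.cases ?_ (fun m => ?_) j') j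
    · change IsOfHodgeType (2 * 3) Y.X 1 pE qE xE2
      exact huτ.map_of_isSmoothProjective hYsp AbelianVariety.isSmoothProjective_holds _
    · change IsOfHodgeType (2 * 3) Y.X 1 pE qE xE1
      exact (huτ.map_of_isSmoothProjective hBEsp AbelianVariety.isSmoothProjective_holds _).map_of_isSmoothProjective
        hYsp hBEsp _
    · change IsOfHodgeType (2 * 3) Y.X 1 (if sF m ∈ Ψ.1 then 1 else 0) (if sF m ∈ Ψ.1 then 0 else 1) (xB m)
      by_cases hsΨ : sF m ∈ Ψ.1
      · rw [if_pos hsΨ, if_pos hsΨ]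
        exact ((isOfHodgeType_oneZero_of_mem hB (hv (sF m)) hsΨ).map_of_isSmoothProjective hBEsp
          AbelianVariety.isSmoothProjective_holds _).map_of_isSmoothProjective hYsp hBEsp _
      · rw [if_neg hsΨ, if_neg hsΨ]
        exact ((isOfHodgeType_zeroOne_of_not_mem hB (hv (sF m)) hsΨ).map_of_isSmoothProjective hBEsp
          AbelianVariety.isSmoothProjective_holds _).map_of_isSmoothProjective hYsp hBEsp _
  -- the count
  have hsumB : ∑ m : Fin 4, (if sF m ∈ Ψ.1 then 1 else 0 : ℕ) =
      (Finset.univ.filter fun s : K →+* ℂ => s.comp i = τ ∧ s ∈ Ψ.1).card := by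
    have h1 : ∑ m : Fin 4, (if sF m ∈ Ψ.1 then 1 else 0 : ℕ) =
        ∑ s ∈ F, (if s ∈ Ψ.1 then 1 else 0 : ℕ) := by
      rw [← Finset.sum_coe_sort F, ← Fintype.sum_equiv e (fun m => (if sF m ∈ Ψ.1 then 1 else 0 : ℕ))
        (fun s => (if (s : K →+* ℂ) ∈ Ψ.1 then 1 else 0 : ℕ)) (fun m => rfl)]
    rw [h1, Finset.sum_boole, Nat.cast_id, hFdef, Finset.filter_filter]
  have hp : ∑ j, p j = 3 := by
    rw [Fin.sum_univ_succ, Fin.sum_univ_succ]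
    simp only [p, Fin.cons_zero, Fin.cons_succ]
    rw [hsumB]
    have h := hcount τ
    simp only [pE] at h ⊢
    omega
  have hpq1 : ∀ j, p j + q j = 1 := by
    intro j
    refine Fin.cases ?_ (fun j' => Fin.cases ?_ (fun m => ?_) j') j
    · change pE + qE = 1
      simp only [pE, qE]; split_ifs <;> rfl
    · change pE + qE = 1
      simp only [pE, qE]; split_ifs <;> rfl
    · change (if sF m ∈ Ψ.1 then 1 else 0) + (if sF m ∈ Ψ.1 then 0 else 1) = 1
      split_ifs <;> rfl
  have hq : ∑ j, q j = 3 := by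
    have h := Finset.sum_add_distrib (s := Finset.univ) (f := p) (g := q)
    rw [Finset.sum_congr rfl fun j _ => hpq1 j, Finset.sum_const, Finset.card_univ, Fintype.card_fin,
      smul_eq_mul, mul_one, hp] at h
    omega
  exact isWeilType_of_cupPowOne φY (m := 3) three_pos hd hdim hφY w hli hw p q hpq hp hq

/-! ## §3 The whole Weil plane of `(B × E) × E` is algebraic, GIVEN Markman's hyperbolic-sixfold theorem -/

/-- **The Weil plane of the CM sixfold `(B × E) × E` is algebraic, GIVEN Markman's hyperbolic-sixfold theorem.**  In the
situation of `isWeilType_cmFourfold_prod_cmCurve_prod_cmCurve`: `weilClassesOf ((B × E) × E) φ 3 d ≤ algebraicClasses _ 3`.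
The pointwise input is ring 2's `Ring2.AbelianAll.weilClasses_algebraic_fourfold_prod_curve_prod_curve_of_markmanSixfolds`
(seat ab-weil-2: a fourfold times two curves carries a HYPERBOLIC weighted Segre polarisation, so Thm 1.5.1 applies
directly); Weil type upgrades it to the complex plane (van Geemen 4.9).  CONDITIONAL on the UNREFEREED named fact
`Markman2025_weilClasses_algebraic_hyperbolicSixfold`; nothing else. [cite: Markman2025SecantWeil, Thm 1.5.1]
[cite: vanGeemen1994HodgeAV, 4.9, Lemma 5.2 (2)–(4) and (5.4.1)] -/
theorem weilClassesOf_le_algebraicClasses_cmFourfold_prod_cmCurve_prod_cmCurve_of_markmanSixfold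
    (hM : Markman2025_weilClasses_algebraic_hyperbolicSixfold)
    (h8 : Module.finrank ℚ K = 8) (h2 : Module.finrank ℚ k = 2) (i : k →+* K)
    {Ψ : CMType K} {B : AbelianVariety ℂ} {ιB : 𝓞 K →+* End B} {θB : K →+* Module.End ℂ (complexBetti B.X 1)}
    (hB : IsCMTypeRealisation Ψ B ιB θB)
    {Φ₀ : CMType k} {E : AbelianVariety ℂ} {ιE : 𝓞 k →+* End E} {θE : k →+* Module.End ℂ (complexBetti E.X 1)}
    (hE : IsCMTypeRealisation Φ₀ E ιE θE)
    {δ : 𝓞 k} {d : ℕ} (hd : 0 < d) (hδ : ((δ : k)) ^ 2 = -(d : k))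
    (hcount : ∀ τ : k →+* ℂ,
      (Finset.univ.filter fun s : K →+* ℂ => s.comp i = τ ∧ s ∈ Ψ.1).card + 2 * (if τ ∈ Φ₀.1 then 1 else 0) = 3) :
    weilClassesOf ((B.prod E).prod E)
      (AbelianVariety.prodLift
        (AbelianVariety.fst (B.prod E) E ≫
          AbelianVariety.prodLift (AbelianVariety.fst B E ≫ ιB (RingOfIntegers.mapRingHom i δ))
            (AbelianVariety.snd B E ≫ ιE δ))
        (AbelianVariety.snd (B.prod E) E ≫ ιE δ)) 3 d ≤ algebraicClasses ((B.prod E).prod E).X 3 := by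
  have hδ𝓞 : δ ^ 2 = -(d : 𝓞 k) := by
    apply RingOfIntegers.ext
    change algebraMap (𝓞 k) k (δ ^ 2) = algebraMap (𝓞 k) k (-(d : 𝓞 k))
    rw [map_pow, map_neg, map_natCast]
    exact hδ
  have hδK𝓞 : (RingOfIntegers.mapRingHom i δ) ^ 2 = -(d : 𝓞 K) := by
    rw [← map_pow, hδ𝓞, map_neg, map_natCast]
  have hWT := isWeilType_cmFourfold_prod_cmCurve_prod_cmCurve h8 h2 i hB hE hd hδ hcount
  have hB4 : B.dim = 4 := by rw [dim_eq_of_isCMTypeRealisation hB, h8]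
  have hE1 : E.dim = 1 := by rw [dim_eq_of_isCMTypeRealisation hE, h2]
  refine hWT.weilClassesOf_le_algebraicClasses fun c hcW hcQ hcH => ?_
  exact Summit.HodgeConjecture.HodgeConjecture.Ring2.AbelianAll.weilClasses_algebraic_fourfold_prod_curve_prod_curve_of_markmanSixfolds
    hM hB4 hE1 hE1 hd (comp_self_eq_neg_of_sq_eq_neg ιB hδK𝓞) (comp_self_eq_neg_of_sq_eq_neg ιE hδ𝓞)
    (comp_self_eq_neg_of_sq_eq_neg ιE hδ𝓞) hWT hcQ hcH hcW

end CM

end Summit.HodgeConjecture.CorCM.OcticCurveFourfold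

end
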